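import Literature.MathematicalPhysics.QuantumFieldTheory.BalabanImbrieJaffe1984to88.BIJ88Resummation5141

/-!
# `BalabanImbrieJaffe1984to88.BIJ88ElementaryRegions304` — T. Bałaban, J. Imbrie, A. Jaffe, *Effective action and cluster properties
of the abelian Higgs model*, Commun. Math. Phys. **114** (1988) 257–315 [BalabanImbrieJaffe1988]: Sect. 5.13, p. 304 — the
**elementary regions `{□_i}_{i∈I}`** (the merging rules (i)–(iv)) CONSTRUCTED as the finest decomposition of the cubes compatible with the
rules, the regrouping *"f(□_i) is the product of all the factors … localized in □_i"* PROVED, and the link with the cluster expansion of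
`BIJ88Resummation5141`: every filling compatible with the Mayer set consists of unions of elementary regions, and in the DECOUPLED case
(expectation factorizing over the □_i — a concrete product model is given) the decoupling hypothesis of (5.14.1) holds with exactly one
surviving filling, so that `z_F = Σ_{fillings} Π g₂` holds outright there.

HONEST FRAMING (cell `lit-balaban`, verbatim): statement-level skeleton of published theorems with citation tags; proofs where landed; nothing here is a claim about the Yang–Mills mass gap.

PDF held: `paper:balaban1988-cmp114-bij-abelian-higgs-effective-action` (journal page = PDF page + 256); p. 304 = PDF p. 48, p. 306 = PDF
p. 50 (renders `original-p048-x2.png`, `original-p050-x2.png` in the seat folder; materialised text `p0048.txt`, `p0050.txt`).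

CITATION HEADER (verbatim).  p. 304 [PDF 48]: *"We decompose Λ₁₀^{(k)} into elementary regions {□_i}_{i∈I} which are connected unions of
□^{(α)}. Two □^{(α)} are included into a □_i if one of the following conditions hold: (i) They are both in some Y, Y ∈ S_Y, (ii) They are
both in some X, X ∈ S₅, (iii) They both contain sites or bonds within r(e_k) of some X_{σ₁}, σ₁ ∈ σ̃₁. (iv) They are both in a connected
component of Λ₁₁^{(k)c}. For the decoupling of the Gaussian measure, we interpolate the covariance with parameters s_i ∈ [0,1], i ∈ I,
which turn off interactions between □_i and □_iᶜ. … = ⟨Π_{i∈I} f(□_i)⟩, where f(□_i) is the product of all the factors under the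
dμ_{Λ₁₀^{(k)}} integral above that are localized in □_i. (Factors localized in Λ₁₀^{(k)c} are assigned to the □_i intersecting the
corresponding component of Λ₁₁^{(k)c}.) Our construction of the □_i ensures no overlap of factors between different □_i's."*  p. 306
[PDF 50]: *"⟨·⟩_{s_Γ,X} is defined by integrating over the fields in X only. … Here g₂(X_α) is obtained by summing over S_Y, S₅ compatible
with X_α (each Y, X is contained in X_α or the corresponding component of Λ₁₁^{(k)c})"*.  p. 307 [PDF 51]: *"Each time some cubes are joined
into one □_i by an e^{−V^{(k)}(Y)} − 1 or an e^{−W₅^{(k)}(X)} − 1 we get a factor e^β(L^kε/ε₀)^{1/4−α} or e^{−cr(e_k)}."*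

WHAT IS REPRODUCED (unit `lit-balaban-p25`, generation 7 of the Phase-2 proof seat p25; SKELETON row `C2.Eq5.13.1-5.13.2`, member
*"elementary regions □_i (p. 303–304)"*; companion of `BIJ88Resummation5141` (row `C2.Eq5.14.1-5.14.2`); HOME
`run/shared/lean/pub/lit-balaban/lit-balaban-p25/`).  MODEL: cubes = a finite index set `W : Finset ι`; the four merging rules are four
families of sets of cubes — the `Y ∈ S_Y`, the `X ∈ S₅`, the r(e_k)-neighbourhoods of the `X_{σ₁}`, the traces of the components of
Λ₁₁^{(k)c} — whose union is the family `J` of JOINING SETS: two cubes lying in a common joining set are merged.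
§1 `IsClosed J W T` (no joining set crosses the boundary of `T` inside `W`), `region J W i` = the cubes of `W` in every closed set
  containing `i` (the class □_i of the cube `i`): `mem_region_self`, minimality `region_subset_of_isClosed`, `isClosed_region`,
  `inter_subset_region` (rule (i): a joining set lies inside the region of each of its cubes), `region_eq_of_mem` (the regions are classes:
  the closure relation is symmetric — `region i ∖ region j` would be a smaller closed set), `region_connected` (*"connected unions"*).
§2 `regions J W` = `{□_i}_{i∈I}`: `isSetPartition_regions` (a decomposition of `W`), `exists_region_superset` (rules (i)–(iv) hold),
  `isClosed_of_block`/`region_subset_block`/`block_eq_biUnion_regions` (FINEST: every decomposition whose blocks contain the joining sets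
  is coarser — its blocks are unions of regions).
§3 THE REGROUPING (`prod_cubes_regroup`, `prod_joining_regroup`, `prod_regroup`): a product of one-cube factors and joining-set factors is
  the product over the regions of `f(□_i)` := (the joining-set factors assigned to `□_i`) · (the cube factors of `□_i`) — each joining set
  meeting `W` is assigned to the unique region containing its cubes in `W` (*"no overlap of factors between different □_i's"*).
§4 LINK WITH (5.14.1) (`BIJ88Resummation5141`): `compat_regions` (the regions of the Mayer set `S` form a compatible filling),
  `region_subset_of_compat` (every compatible filling consists of unions of regions), `region_restrict_of_isClosed` /
  `regions_restrict_of_isClosed` / `regions_restrict_region` (inside a closed block the regions for the polymers inside it are the global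
  regions — locality), and the DECOUPLED CASE: with activities `gOne e X T = [X is a single T-region]·e X T`, **`sum_compat_gOne`** (the
  cluster sum over the compatible fillings has exactly one surviving term, the regions), `hdec_of_factorizes` (if ⟨G Π_{Y∈S}(b_Y − 1)⟩
  factorizes over the regions of `S` — ⟨Π f(□_i)⟩ = Π⟨f(□_i)⟩, the situation "at s = 0" — the displayed hypothesis `hdec` of
  `BIJ88Resummation5141.eq5141` holds), `zF_eq_sum_fillings_of_factorizes`.
§5 A CONCRETE DECOUPLED MODEL (`prodE`, `DependsOn`, `extend`, `eProd`): finitely many field values `Ω` per cube, the product (counting)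
  expectation `prodE ω₀ U h = Σ_{g : U → Ω} h(g extended by ω₀)` as a linear functional, `prodE_union_mul` (factorization over disjoint
  regions for localized factors, via `Equiv.piFinsetUnion`), `prodE_biUnion_prod` (over a filling), **`zS_prodE_eq_prod_regions`** (the
  factorization hypothesis HOLDS for one-cube factors `f α` and polymer factors `b Y` localized in `Y`), **`zF_prodE_eq_sum_fillings`**
  (`z_F = Σ_{fillings} Π g₂` in this model with no hypothesis beyond the nonemptiness of the Mayer polymers — a non-vacuity witness for the
  hypotheses of `BIJ88Resummation5141.zF_eq_sum_fillings` with the printed locality of the activities).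
READINGS (declared): (a) rules (iii)/(iv) enter only through their joining sets (the neighbourhoods / component traces as sets of
cubes), the geometry is not modelled; (b) a joining set need not lie inside `W` — only its cubes in `W` are merged and carry its factor
(p. 304: factors localized outside Λ₁₀ are assigned to a □_i meeting the component); (c) §4–§5 concern the DECOUPLED case only: the
interpolation in `s` and the expansion (5.13.3), which produce clusters that are unions of SEVERAL elementary regions, are rows
`C2.Eq5.13.3-5.13.4` and are not reproduced.  All statements are finite identities / set-theoretic facts about finite sets; 0 `sorry`,
0 new `Prop` facts.  Non-vacuity checked by `decide` (seat scratch): `regions {{0,1},{1,2}} {0,1,2,3} = {{0,1,2},{3}}`,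
`regions {{1,2}} {0,1} = {{0},{1}}`, `regions {{0,1}} {0,1,2} = {{0,1},{2}}`.
-/

open Finset
open Literature.Probability.LatticeModels (IsSetPartition setPartitions mem_setPartitions)
open Literature.MathematicalPhysics.QuantumFieldTheory.BalabanImbrieJaffe1984to88.BIJ88Resummation5141 (polysIn mem_polysIn Compat
  restrictTo mem_restrictTo g2 zS zF boltz mayer eq5134_exchange zF_eq_sum_fillings)

namespace Literature.MathematicalPhysics.QuantumFieldTheory.BalabanImbrieJaffe1984to88.BIJ88ElementaryRegions304

variable {ι : Type*} [DecidableEq ι]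

/-! ## §1 The merging rules (i)–(iv) as joining sets; closed sets of cubes; the elementary region of a cube -/

/-- p. 304 [PDF 48], the merging rules, verbatim: *"Two □^{(α)} are included into a □_i if one of the following conditions hold: (i) They are
both in some Y, Y ∈ S_Y, (ii) They are both in some X, X ∈ S₅, (iii) They both contain sites or bonds within r(e_k) of some X_{σ₁}, σ₁ ∈ σ̃₁.
(iv) They are both in a connected component of Λ₁₁^{(k)c}."* — each rule says: two cubes lying in a common member of a family of sets of
cubes (the `Y ∈ S_Y`; the `X ∈ S₅`; the r(e_k)-neighbourhoods of the `X_{σ₁}`; the traces of the components of Λ₁₁^{(k)c}) are merged. We call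
the members of the union `J` of these four families JOINING SETS; a set `T` of cubes of the region `W` is CLOSED when every joining set
meeting `T` has all its cubes of `W` in `T`. [cite: BalabanImbrieJaffe1988, p.304 (Sect. 5.13)] -/
def IsClosed (J : Finset (Finset ι)) (W T : Finset ι) : Prop := ∀ Y ∈ J, (Y ∩ T).Nonempty → Y ∩ W ⊆ T

/-- decidability of closedness. [cite: BalabanImbrieJaffe1988, p.304 (Sect. 5.13)] -/
instance instDecidableIsClosed (J : Finset (Finset ι)) (W T : Finset ι) : Decidable (IsClosed J W T) :=
  inferInstanceAs (Decidable (∀ Y ∈ J, (Y ∩ T).Nonempty → Y ∩ W ⊆ T))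

/-- **the elementary region □_i of the cube `i`** (p. 304: *"We decompose Λ₁₀^{(k)} into elementary regions {□_i}_{i∈I} which are connected
unions of □^{(α)}"*): the cubes of `W` lying in EVERY closed set of cubes containing `i` — the smallest closed set containing `i`, i.e. the
class of `i` under the merging rules. [cite: BalabanImbrieJaffe1988, p.304 (Sect. 5.13)] -/
def region (J : Finset (Finset ι)) (W : Finset ι) (i : ι) : Finset ι :=
  W.filter fun j => ∀ T ∈ W.powerset, i ∈ T → IsClosed J W T → j ∈ T

/-- an elementary region lies in the region `W`. [cite: BalabanImbrieJaffe1988, p.304 (Sect. 5.13)] -/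
theorem region_subset (J : Finset (Finset ι)) (W : Finset ι) (i : ι) : region J W i ⊆ W := filter_subset _ _

/-- membership in an elementary region. [cite: BalabanImbrieJaffe1988, p.304 (Sect. 5.13)] -/
theorem mem_region {J : Finset (Finset ι)} {W : Finset ι} {i j : ι} :
    j ∈ region J W i ↔ j ∈ W ∧ ∀ T ⊆ W, i ∈ T → IsClosed J W T → j ∈ T := by
  simp only [region, mem_filter, mem_powerset]

/-- a cube lies in its own elementary region. [cite: BalabanImbrieJaffe1988, p.304 (Sect. 5.13)] -/
theorem mem_region_self {J : Finset (Finset ι)} {W : Finset ι} {i : ι} (hi : i ∈ W) : i ∈ region J W i :=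
  mem_region.2 ⟨hi, fun _ _ hiT _ => hiT⟩

/-- **minimality**: the elementary region of `i` lies in every closed set containing `i`. [cite: BalabanImbrieJaffe1988, p.304 (Sect. 5.13)] -/
theorem region_subset_of_isClosed {J : Finset (Finset ι)} {W T : Finset ι} {i : ι} (hT : T ⊆ W) (hiT : i ∈ T)
    (hc : IsClosed J W T) : region J W i ⊆ T := fun _ hj => (mem_region.1 hj).2 T hT hiT hc

/-- **closedness**: an elementary region is closed under the merging rules (a joining set meeting it lies inside it).
[cite: BalabanImbrieJaffe1988, p.304 (Sect. 5.13)] -/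
theorem isClosed_region (J : Finset (Finset ι)) (W : Finset ι) (i : ι) : IsClosed J W (region J W i) := by
  intro Y hY hne y hy
  obtain ⟨k, hk⟩ := hne
  obtain ⟨hkY, hkR⟩ := mem_inter.1 hk
  obtain ⟨hyY, hyW⟩ := mem_inter.1 hy
  refine mem_region.2 ⟨hyW, fun T hT hiT hc => ?_⟩
  have hkT : k ∈ T := (mem_region.1 hkR).2 T hT hiT hc
  exact hc Y hY ⟨k, mem_inter.2 ⟨hkY, hkT⟩⟩ (mem_inter.2 ⟨hyY, hyW⟩)

/-- *"(i) They are both in some Y"*: a joining set meeting `W` lies, within `W`, inside the elementary region of each of its cubes.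
[cite: BalabanImbrieJaffe1988, p.304 (Sect. 5.13)] -/
theorem inter_subset_region {J : Finset (Finset ι)} {W : Finset ι} {Y : Finset ι} (hY : Y ∈ J) {k : ι} (hkY : k ∈ Y) (hkW : k ∈ W) :
    Y ∩ W ⊆ region J W k :=
  isClosed_region J W k Y hY ⟨k, mem_inter.2 ⟨hkY, mem_region_self hkW⟩⟩

/-- **the elementary regions are classes**: a cube of the region of `i ∈ W` has the same region (the relation "included into the same
□_i" is symmetric and transitive). [cite: BalabanImbrieJaffe1988, p.304 (Sect. 5.13)] -/
theorem region_eq_of_mem {J : Finset (Finset ι)} {W : Finset ι} {i j : ι} (hi : i ∈ W) (hj : j ∈ region J W i) :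
    region J W j = region J W i := by
  have hjW : j ∈ W := region_subset J W i hj
  refine Subset.antisymm (region_subset_of_isClosed (region_subset J W i) hj (isClosed_region J W i)) ?_
  -- `i ∈ region j`: otherwise `region i ∖ region j` is a closed set containing `i`, hence contains `region i ∋ j` — absurd
  by_contra hcon
  have hiR : i ∉ region J W j := fun h =>
    hcon (region_subset_of_isClosed (region_subset J W j) h (isClosed_region J W j))
  have hcl : IsClosed J W (region J W i \ region J W j) := by
    intro Y hY hne y hy
    obtain ⟨k, hk⟩ := hne
    obtain ⟨hkY, hk'⟩ := mem_inter.1 hk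
    obtain ⟨hki, hkj⟩ := mem_sdiff.1 hk'
    have hyi : y ∈ region J W i := isClosed_region J W i Y hY ⟨k, mem_inter.2 ⟨hkY, hki⟩⟩ hy
    refine mem_sdiff.2 ⟨hyi, fun hyj => hkj ?_⟩
    exact isClosed_region J W j Y hY ⟨y, mem_inter.2 ⟨(mem_inter.1 hy).1, hyj⟩⟩
      (mem_inter.2 ⟨hkY, region_subset J W i hki⟩)
  have hsub' : region J W i ⊆ region J W i \ region J W j :=
    region_subset_of_isClosed (sdiff_subset.trans (region_subset J W i)) (mem_sdiff.2 ⟨mem_region_self hi, hiR⟩) hcl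
  exact (mem_sdiff.1 (hsub' hj)).2 (mem_region_self hjW)

/-- *"connected unions of □^{(α)}"*: an elementary region has no proper closed subset containing its cube. [cite: BalabanImbrieJaffe1988, p.304 (Sect. 5.13)] -/
theorem region_connected {J : Finset (Finset ι)} {W T : Finset ι} {i : ι} (hT : T ⊆ region J W i) (hiT : i ∈ T)
    (hc : IsClosed J W T) : T = region J W i :=
  Subset.antisymm hT (region_subset_of_isClosed (hT.trans (region_subset J W i)) hiT hc)

/-! ## §2 The decomposition `{□_i}_{i∈I}` of the region: a set partition, the finest one compatible with the merging rules -/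

/-- p. 304 [PDF 48], verbatim: *"We decompose Λ₁₀^{(k)} into elementary regions {□_i}_{i∈I}"* — the family of the elementary regions of the
cubes of `W`. [cite: BalabanImbrieJaffe1988, p.304 (Sect. 5.13)] -/
def regions (J : Finset (Finset ι)) (W : Finset ι) : Finset (Finset ι) := W.image (region J W)

/-- membership in `regions`. [cite: BalabanImbrieJaffe1988, p.304 (Sect. 5.13)] -/
theorem mem_regions {J : Finset (Finset ι)} {W R : Finset ι} : R ∈ regions J W ↔ ∃ i ∈ W, region J W i = R := mem_image

/-- the region of a cube of `W` is one of the regions. [cite: BalabanImbrieJaffe1988, p.304 (Sect. 5.13)] -/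
theorem region_mem_regions {J : Finset (Finset ι)} {W : Finset ι} {i : ι} (hi : i ∈ W) : region J W i ∈ regions J W :=
  mem_image_of_mem _ hi

/-- **the elementary regions DECOMPOSE the region** (a set partition of the cubes of `W`). [cite: BalabanImbrieJaffe1988, p.304 (Sect. 5.13)] -/
theorem isSetPartition_regions (J : Finset (Finset ι)) (W : Finset ι) : IsSetPartition W (regions J W) := by
  refine ⟨fun P hP => ?_, fun h => ?_, fun v hv => ⟨region J W v, region_mem_regions hv, mem_region_self hv⟩,
    fun P hP Q hQ v hvP hvQ => ?_⟩
  · obtain ⟨i, -, rfl⟩ := mem_regions.1 hP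
    exact region_subset J W i
  · obtain ⟨i, hi, he⟩ := mem_regions.1 h
    exact (notMem_empty i) (he ▸ mem_region_self hi)
  · obtain ⟨i, hi, rfl⟩ := mem_regions.1 hP
    obtain ⟨j, hj, rfl⟩ := mem_regions.1 hQ
    rw [← region_eq_of_mem hi hvP, region_eq_of_mem hj hvQ]

/-- the elementary regions are a filling of the region (in the sense of `BIJ88Resummation5141`: a set partition of its cubes).
[cite: BalabanImbrieJaffe1988, p.304 (Sect. 5.13)] -/
theorem regions_mem_setPartitions (J : Finset (Finset ι)) (W : Finset ι) : regions J W ∈ setPartitions W :=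
  mem_setPartitions.2 (isSetPartition_regions J W)

/-- **each joining set lies in one elementary region** (rules (i)–(iv) are satisfied). [cite: BalabanImbrieJaffe1988, p.304 (Sect. 5.13)] -/
theorem exists_region_superset {J : Finset (Finset ι)} {W Y : Finset ι} (hY : Y ∈ J) (hne : (Y ∩ W).Nonempty) :
    ∃ R ∈ regions J W, Y ∩ W ⊆ R := by
  obtain ⟨k, hk⟩ := hne
  obtain ⟨hkY, hkW⟩ := mem_inter.1 hk
  exact ⟨region J W k, region_mem_regions hkW, inter_subset_region hY hkY hkW⟩

/-- a block of ANY decomposition of `W` whose blocks contain the joining sets is closed. [cite: BalabanImbrieJaffe1988, p.304 (Sect. 5.13)] -/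
theorem isClosed_of_block {J : Finset (Finset ι)} {W : Finset ι} {π : Finset (Finset ι)} (hπ : IsSetPartition W π)
    (hJ : ∀ Y ∈ J, (Y ∩ W).Nonempty → ∃ P ∈ π, Y ∩ W ⊆ P) {P : Finset ι} (hP : P ∈ π) : IsClosed J W P := by
  intro Y hY hne
  obtain ⟨k, hk⟩ := hne
  obtain ⟨hkY, hkP⟩ := mem_inter.1 hk
  have hkW : k ∈ W := hπ.subset hP hkP
  obtain ⟨P', hP', hsub⟩ := hJ Y hY ⟨k, mem_inter.2 ⟨hkY, hkW⟩⟩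
  rwa [← hπ.eq_of_mem hP' hP (hsub (mem_inter.2 ⟨hkY, hkW⟩)) hkP]

/-- **the elementary regions form the FINEST such decomposition**: every block of a decomposition of `W` whose blocks contain the joining
sets is a union of elementary regions (it contains the region of each of its cubes). [cite: BalabanImbrieJaffe1988, p.304 (Sect. 5.13)] -/
theorem region_subset_block {J : Finset (Finset ι)} {W : Finset ι} {π : Finset (Finset ι)} (hπ : IsSetPartition W π)
    (hJ : ∀ Y ∈ J, (Y ∩ W).Nonempty → ∃ P ∈ π, Y ∩ W ⊆ P) {P : Finset ι} (hP : P ∈ π) {i : ι} (hiP : i ∈ P) :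
    region J W i ⊆ P :=
  region_subset_of_isClosed (hπ.subset hP) hiP (isClosed_of_block hπ hJ hP)

/-- the same, as an equation: such a block is the union of the elementary regions it contains. [cite: BalabanImbrieJaffe1988, p.304 (Sect. 5.13)] -/
theorem block_eq_biUnion_regions {J : Finset (Finset ι)} {W : Finset ι} {π : Finset (Finset ι)} (hπ : IsSetPartition W π)
    (hJ : ∀ Y ∈ J, (Y ∩ W).Nonempty → ∃ P ∈ π, Y ∩ W ⊆ P) {P : Finset ι} (hP : P ∈ π) :
    P = ((regions J W).filter (· ⊆ P)).biUnion id := by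
  ext v
  simp only [mem_biUnion, mem_filter, id]
  constructor
  · intro hv
    exact ⟨region J W v, ⟨region_mem_regions (hπ.subset hP hv), region_subset_block hπ hJ hP hv⟩,
      mem_region_self (hπ.subset hP hv)⟩
  · rintro ⟨R, ⟨-, hRP⟩, hvR⟩
    exact hRP hvR

/-! ## §3 *"f(□_i) is the product of all the factors … localized in □_i"*: regrouping a product of localized factors -/

/-- the one-cube factors regroup over the elementary regions. [cite: BalabanImbrieJaffe1988, p.304 (Sect. 5.13)] -/
theorem prod_cubes_regroup {R : Type*} [CommMonoid R] (J : Finset (Finset ι)) (W : Finset ι) (f : ι → R) :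
    ∏ α ∈ W, f α = ∏ P ∈ regions J W, ∏ α ∈ P, f α := by
  conv_lhs => rw [← (isSetPartition_regions J W).biUnion_id]
  exact prod_biUnion (isSetPartition_regions J W).pairwiseDisjoint

/-- the joining-set factors (the `e^{−V^{(k)}(Y)} − 1`, `e^{−W₅^{(k)}(X)} − 1`, the observables near the `X_{σ₁}`, the factors of a component
of Λ₁₁^{(k)c}) regroup over the elementary regions: each is assigned to the region containing (the cubes in `W` of) its joining set —
*"Our construction of the □_i ensures no overlap of factors between different □_i's"*. [cite: BalabanImbrieJaffe1988, p.304 (Sect. 5.13)] -/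
theorem prod_joining_regroup {R : Type*} [CommMonoid R] {J : Finset (Finset ι)} {W : Finset ι} {J' : Finset (Finset ι)} (hJ' : J' ⊆ J)
    (hne : ∀ Y ∈ J', (Y ∩ W).Nonempty) (m : Finset ι → R) :
    ∏ Y ∈ J', m Y = ∏ P ∈ regions J W, ∏ Y ∈ J'.filter (fun Y => Y ∩ W ⊆ P), m Y := by
  have hcover : J' = (regions J W).biUnion fun P => J'.filter fun Y => Y ∩ W ⊆ P := by
    ext Y
    simp only [mem_biUnion, mem_filter]
    constructor
    · intro hY
      obtain ⟨P, hP, hsub⟩ := exists_region_superset (hJ' hY) (hne Y hY)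
      exact ⟨P, hP, hY, hsub⟩
    · rintro ⟨P, -, hY, -⟩
      exact hY
  have hdisj : ((regions J W : Finset (Finset ι)) : Set (Finset ι)).PairwiseDisjoint
      fun P => J'.filter fun Y => Y ∩ W ⊆ P := by
    intro P hP Q hQ hPQ
    rw [Function.onFun, disjoint_left]
    intro Y hYP hYQ
    obtain ⟨hY, hP'⟩ := mem_filter.1 hYP
    obtain ⟨-, hQ'⟩ := mem_filter.1 hYQ
    obtain ⟨k, hk⟩ := hne Y hY
    exact hPQ ((isSetPartition_regions J W).eq_of_mem hP hQ (hP' hk) (hQ' hk))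
  conv_lhs => rw [hcover]
  exact prod_biUnion hdisj

/-- **p. 304**, verbatim: *"… = ⟨Π_{i∈I} f(□_i)⟩, where f(□_i) is the product of all the factors under the dμ_{Λ₁₀^{(k)}} integral above that
are localized in □_i. … Our construction of the □_i ensures no overlap of factors between different □_i's."* — the integrand, a product
of joining-set factors `m` and one-cube factors `f`, is the product over the elementary regions of `f(□_i) :=` (the joining-set factors
assigned to `□_i`) · (the cube factors of `□_i`). [cite: BalabanImbrieJaffe1988, p.304 (Sect. 5.13)] -/
theorem prod_regroup {R : Type*} [CommMonoid R] {J : Finset (Finset ι)} {W : Finset ι} {J' : Finset (Finset ι)} (hJ' : J' ⊆ J)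
    (hne : ∀ Y ∈ J', (Y ∩ W).Nonempty) (m : Finset ι → R) (f : ι → R) :
    (∏ Y ∈ J', m Y) * ∏ α ∈ W, f α =
      ∏ P ∈ regions J W, ((∏ Y ∈ J'.filter (fun Y => Y ∩ W ⊆ P), m Y) * ∏ α ∈ P, f α) := by
  rw [prod_joining_regroup hJ' hne m, prod_cubes_regroup J W f, prod_mul_distrib]

/-! ## §4 Link with the cluster expansion: compatible fillings are unions of elementary regions; the decoupled case -/

/-- inside a region containing all the Mayer polymers of `S` (nonempty sets of cubes), the elementary regions for the joining family `S`
form a filling COMPATIBLE with `S` in the sense of `BIJ88Resummation5141.Compat`. [cite: BalabanImbrieJaffe1988, p.306 (Sect. 5.13)] -/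
theorem compat_regions {S : Finset (Finset ι)} {W' : Finset ι} (hS : ∀ Y ∈ S, Y ⊆ W') (hne : ∀ Y ∈ S, Y.Nonempty) :
    Compat (regions S W') S := by
  intro Y hY
  obtain ⟨k, hk⟩ := hne Y hY
  refine ⟨region S W' k, region_mem_regions (hS Y hY hk), fun y hy => ?_⟩
  exact inter_subset_region hY hk (hS Y hY hk) (mem_inter.2 ⟨hy, hS Y hY hy⟩)

/-- **every filling compatible with `S` consists of unions of elementary regions** (its blocks contain the regions of their cubes).
[cite: BalabanImbrieJaffe1988, p.306 (Sect. 5.13)] -/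
theorem region_subset_of_compat {S : Finset (Finset ι)} {W' : Finset ι} {κ : Finset (Finset ι)} (hκ : IsSetPartition W' κ)
    (hc : Compat κ S) {X : Finset ι} (hX : X ∈ κ) {i : ι} (hi : i ∈ X) : region S W' i ⊆ X :=
  region_subset_block hκ (fun Y hY _ => by
    obtain ⟨P, hP, hYP⟩ := hc Y hY
    exact ⟨P, hP, inter_subset_left.trans hYP⟩) hX hi

/-- the blocks of a compatible filling are closed. [cite: BalabanImbrieJaffe1988, p.306 (Sect. 5.13)] -/
theorem isClosed_of_compat {S : Finset (Finset ι)} {W' : Finset ι} {κ : Finset (Finset ι)} (hκ : IsSetPartition W' κ)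
    (hc : Compat κ S) {X : Finset ι} (hX : X ∈ κ) : IsClosed S W' X :=
  isClosed_of_block hκ (fun Y hY _ => by
    obtain ⟨P, hP, hYP⟩ := hc Y hY
    exact ⟨P, hP, inter_subset_left.trans hYP⟩) hX

/-- **localization to a closed block**: inside a closed set of cubes `X` the elementary regions for the Mayer polymers inside `X` are the
elementary regions (for all of `S`) of the cubes of `X` (p. 306: the activity of a cluster sees only what is inside it).
[cite: BalabanImbrieJaffe1988, p.306 (Sect. 5.13)] -/
theorem region_restrict_of_isClosed {S : Finset (Finset ι)} {W' X : Finset ι} (hS : ∀ Y ∈ S, Y ⊆ W') (hX : X ⊆ W')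
    (hXc : IsClosed S W' X) {i : ι} (hi : i ∈ X) : region (restrictTo S X) X i = region S W' i := by
  have hiW : i ∈ W' := hX hi
  -- `region S W' i ⊆ X` and it is closed for the polymers inside `X`
  have h1 : region S W' i ⊆ X := region_subset_of_isClosed hX hi hXc
  refine Subset.antisymm (region_subset_of_isClosed h1 (mem_region_self hiW) fun Y hY hm => ?_) ?_
  · obtain ⟨hYS, -⟩ := mem_restrictTo.1 hY
    intro y hy
    exact isClosed_region S W' i Y hYS hm (mem_inter.2 ⟨(mem_inter.1 hy).1, hS Y hYS (mem_inter.1 hy).1⟩)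
  · -- the restricted region is closed for all of `S`
    refine region_subset_of_isClosed ((region_subset _ X i).trans hX) (mem_region_self hi) fun Y hYS hm => ?_
    have hmX : (Y ∩ X).Nonempty := by
      obtain ⟨k, hk⟩ := hm
      exact ⟨k, mem_inter.2 ⟨(mem_inter.1 hk).1, region_subset _ X i (mem_inter.1 hk).2⟩⟩
    have hYX : Y ⊆ X := fun y hy => hXc Y hYS hmX (mem_inter.2 ⟨hy, hS Y hYS hy⟩)
    have hYr : Y ∈ restrictTo S X := mem_restrictTo.2 ⟨hYS, hYX⟩
    intro y hy
    exact isClosed_region (restrictTo S X) X i Y hYr hm (mem_inter.2 ⟨(mem_inter.1 hy).1, hYX (mem_inter.1 hy).1⟩)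

/-- the elementary regions inside a closed block `X` (for the polymers inside `X`) are the elementary regions contained in `X`.
[cite: BalabanImbrieJaffe1988, p.306 (Sect. 5.13)] -/
theorem regions_restrict_of_isClosed {S : Finset (Finset ι)} {W' X : Finset ι} (hS : ∀ Y ∈ S, Y ⊆ W') (hX : X ⊆ W')
    (hXc : IsClosed S W' X) : regions (restrictTo S X) X = (regions S W').filter (· ⊆ X) := by
  ext R
  simp only [mem_regions, mem_filter]
  constructor
  · rintro ⟨i, hi, rfl⟩
    rw [region_restrict_of_isClosed hS hX hXc hi]
    exact ⟨⟨i, hX hi, rfl⟩, region_subset_of_isClosed hX hi hXc⟩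
  · rintro ⟨⟨i, hi, rfl⟩, hsub⟩
    have hiX : i ∈ X := hsub (mem_region_self hi)
    exact ⟨i, hiX, region_restrict_of_isClosed hS hX hXc hiX⟩

/-- an elementary region is a single elementary region for the polymers inside it. [cite: BalabanImbrieJaffe1988, p.306 (Sect. 5.13)] -/
theorem regions_restrict_region {S : Finset (Finset ι)} {W' : Finset ι} (hS : ∀ Y ∈ S, Y ⊆ W') {R : Finset ι} (hR : R ∈ regions S W') :
    regions (restrictTo S R) R = {R} := by
  obtain ⟨i, hi, rfl⟩ := mem_regions.1 hR
  rw [regions_restrict_of_isClosed hS (region_subset S W' i) (isClosed_region S W' i)]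
  ext P
  simp only [mem_filter, mem_singleton]
  constructor
  · rintro ⟨hP, hsub⟩
    obtain ⟨j, hj, rfl⟩ := mem_regions.1 hP
    exact region_eq_of_mem hi (hsub (mem_region_self hj))
  · rintro rfl
    exact ⟨region_mem_regions hi, Subset.rfl⟩

section Decoupled

variable {R : Type*} [CommRing R]

/-- the activity of the DECOUPLED case: a cluster `X` with the Mayer polymers `T` inside it carries `e X T` if it is a single elementary
region for `T` (the cubes of `X` are all *"joined"* through the `Y ∈ T`, rule (i)), and `0` otherwise (p. 307: *"Each time some cubes are
joined into one □_i by an e^{−V^{(k)}(Y)} − 1 … we get a factor"*). [cite: BalabanImbrieJaffe1988, p.306 (Sect. 5.13)] -/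
def gOne (e : Finset ι → Finset (Finset ι) → R) (X : Finset ι) (T : Finset (Finset ι)) : R :=
  if regions T X = {X} then e X T else 0

omit [DecidableEq ι] in
/-- two fillings, one refining the other as families (`κ ⊆ κ₀`), coincide. [cite: BalabanImbrieJaffe1988, p.306 (Sect. 5.13)] -/
theorem eq_of_subset_of_isSetPartition {W' : Finset ι} {κ κ₀ : Finset (Finset ι)} (hκ : IsSetPartition W' κ)
    (hκ₀ : IsSetPartition W' κ₀) (h : κ ⊆ κ₀) : κ = κ₀ := by
  refine Subset.antisymm h fun P hP => ?_
  obtain ⟨v, hv⟩ := hκ₀.nonempty_of_mem hP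
  obtain ⟨Q, hQ, hvQ⟩ := hκ.exists_mem (hκ₀.subset hP hv)
  rwa [← hκ₀.eq_of_mem (h hQ) hP hvQ hv]

/-- **In the decoupled case exactly one compatible filling survives — the elementary regions.**  With the activities `gOne e`, the
cluster sum of the fixed-Mayer-set decoupling expansion (the right side of the hypothesis `hdec` of `BIJ88Resummation5141.eq5141`) over the
fillings of `W'` compatible with `S` reduces to the single term `{X_α} = {□_i}` = the elementary regions of `S`: every other compatible
filling has a block that is a union of two or more elementary regions. [cite: BalabanImbrieJaffe1988, p.306 (Sect. 5.13)] -/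
theorem sum_compat_gOne {S : Finset (Finset ι)} {W' : Finset ι} (hS : ∀ Y ∈ S, Y ⊆ W') (hne : ∀ Y ∈ S, Y.Nonempty)
    (e : Finset ι → Finset (Finset ι) → R) :
    ∑ κ ∈ setPartitions W', (if Compat κ S then ∏ X ∈ κ, gOne e X (restrictTo S X) else 0) =
      ∏ P ∈ regions S W', e P (restrictTo S P) := by
  rw [sum_eq_single_of_mem (regions S W') (regions_mem_setPartitions S W')]
  · rw [if_pos (compat_regions hS hne)]
    refine prod_congr rfl fun P hP => ?_
    rw [gOne, if_pos (regions_restrict_region hS hP)]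
  · intro κ hκ hne'
    have hκ' := mem_setPartitions.1 hκ
    by_cases hc : Compat κ S
    · rw [if_pos hc]
      -- some block of `κ` is not a single elementary region, else `κ ⊆ regions S W'` and the two fillings coincide
      by_contra hprod
      apply hne'
      refine eq_of_subset_of_isSetPartition hκ' (isSetPartition_regions S W') fun X hX => ?_
      have hXW : X ⊆ W' := hκ'.subset hX
      have hsingle : regions (restrictTo S X) X = {X} := by
        by_contra h
        exact hprod (prod_eq_zero hX (by rw [gOne, if_neg h]))
      rw [regions_restrict_of_isClosed hS hXW (isClosed_of_compat hκ' hc hX)] at hsingle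
      have : X ∈ (regions S W').filter (· ⊆ X) := by rw [hsingle]; exact mem_singleton_self X
      exact (mem_filter.1 this).1
    · rw [if_neg hc]

/-- **The decoupling hypothesis `hdec` of (5.14.1) in the decoupled case.**  If, for every Mayer set `S` inside the large-field-free region
`W'`, the expectation `⟨G_{W'} Π_{Y∈S}(e^{−V(Y)} − 1)⟩_{1,W'}` FACTORIZES over the elementary regions of `S` — the situation *"at s = 0"* of
the interpolation of Sect. 5.13, where the interpolated covariance does not couple different □_i and ⟨Π_{i∈I} f(□_i)⟩ = Π_i ⟨f(□_i)⟩ — then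
the displayed hypothesis `hdec` of `BIJ88Resummation5141.eq5141`/`zF_eq_sum_fillings` holds with the activities `gOne e` (a non-vacuous
instance of that hypothesis with the printed locality: `g₁(X; ·)` depends only on the polymers inside `X`).
[cite: BalabanImbrieJaffe1988, (5.14.1) p.308] -/
theorem hdec_of_factorizes {Φ : Type*} (E : Finset ι → (Φ → R) →ₗ[R] R) (G : Finset ι → Φ → R) (Ys : Finset (Finset ι))
    (b : Finset ι → Φ → R) (e : Finset ι → Finset (Finset ι) → R) (W' : Finset ι) (hYs : ∀ Y ∈ Ys, Y.Nonempty)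
    (hfac : ∀ S ⊆ polysIn Ys W', zS E G b W' S = ∏ P ∈ regions S W', e P (restrictTo S P)) :
    ∀ S ⊆ polysIn Ys W',
      zS E G b W' S = ∑ κ ∈ setPartitions W', if Compat κ S then ∏ X ∈ κ, gOne e X (restrictTo S X) else 0 := by
  intro S hS
  rw [hfac S hS, sum_compat_gOne (fun Y hY => (mem_polysIn.1 (hS hY)).2) (fun Y hY => hYs Y (mem_polysIn.1 (hS hY)).1) e]

/-- hence, in the decoupled case, **`z_F(W') = Σ_{fillings} Π g₂` holds outright** with `g₂(X) = Σ_{T ⊆ 𝒫(X): X a single T-region} e X T`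
(`BIJ88Resummation5141.zF_eq_sum_fillings` with its hypothesis discharged by `hdec_of_factorizes`). [cite: BalabanImbrieJaffe1988, (5.14.1) p.308] -/
theorem zF_eq_sum_fillings_of_factorizes {Φ : Type*} (E : Finset ι → (Φ → R) →ₗ[R] R) (G : Finset ι → Φ → R)
    (Ys : Finset (Finset ι)) (b : Finset ι → Φ → R) (e : Finset ι → Finset (Finset ι) → R) (W' : Finset ι)
    (hYs : ∀ Y ∈ Ys, Y.Nonempty) (hfac : ∀ S ⊆ polysIn Ys W', zS E G b W' S = ∏ P ∈ regions S W', e P (restrictTo S P)) :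
    zF E G Ys b W' = ∑ κ ∈ setPartitions W', ∏ X ∈ κ, g2 Ys (gOne e) X :=
  zF_eq_sum_fillings hYs (hdec_of_factorizes E G Ys b e W' hYs hfac)

end Decoupled

/-! ## §5 A concrete decoupled model: finitely many field values per cube, product expectation -/

section ProductModel

variable {Ω : Type*} {R : Type*}

/-- a function of the field configuration `φ : ι → Ω` (one local configuration per cube) is LOCALIZED in the set of cubes `U` if it
only depends on the configuration on `U` (p. 304: *"factors … localized in □_i"*). [cite: BalabanImbrieJaffe1988, p.304 (Sect. 5.13)] -/
def DependsOn (h : (ι → Ω) → R) (U : Finset ι) : Prop := ∀ φ ψ : ι → Ω, (∀ i ∈ U, φ i = ψ i) → h φ = h ψ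

omit [DecidableEq ι] in
/-- localization is monotone in the set of cubes. [cite: BalabanImbrieJaffe1988, p.304 (Sect. 5.13)] -/
theorem DependsOn.mono {h : (ι → Ω) → R} {U V : Finset ι} (hh : DependsOn h U) (hUV : U ⊆ V) : DependsOn h V :=
  fun φ ψ hφψ => hh φ ψ fun i hi => hφψ i (hUV hi)

omit [DecidableEq ι] in
/-- products of localized factors are localized. [cite: BalabanImbrieJaffe1988, p.304 (Sect. 5.13)] -/
theorem DependsOn.mul [CommRing R] {h h' : (ι → Ω) → R} {U : Finset ι} (hh : DependsOn h U) (hh' : DependsOn h' U) : DependsOn (h * h') U :=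
  fun φ ψ hφψ => by rw [Pi.mul_apply, Pi.mul_apply, hh φ ψ hφψ, hh' φ ψ hφψ]

omit [DecidableEq ι] in
/-- `e^{−V(Y)} − 1` is localized where `e^{−V(Y)}` is. [cite: BalabanImbrieJaffe1988, p.304 (Sect. 5.13)] -/
theorem DependsOn.sub_one [CommRing R] {h : (ι → Ω) → R} {U : Finset ι} (hh : DependsOn h U) :
    DependsOn (fun φ => h φ - 1) U :=
  fun φ ψ hφψ => by
    show h φ - 1 = h ψ - 1
    rw [hh φ ψ hφψ]

omit [DecidableEq ι] in
/-- finite products of localized factors are localized. [cite: BalabanImbrieJaffe1988, p.304 (Sect. 5.13)] -/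
theorem DependsOn.prod [CommRing R] {γ : Type*} (s : Finset γ) (F : γ → (ι → Ω) → R) {U : Finset ι} (hF : ∀ c ∈ s, DependsOn (F c) U) :
    DependsOn (fun φ => ∏ c ∈ s, F c φ) U :=
  fun φ ψ hφψ => prod_congr rfl fun c hc => hF c hc φ ψ hφψ

/-- the configuration equal to `g` on the cubes of `U` and to the base point `ω₀` elsewhere. [cite: BalabanImbrieJaffe1988, p.304 (Sect. 5.13)] -/
def extend (ω₀ : Ω) (U : Finset ι) (g : U → Ω) : ι → Ω := fun i => if h : i ∈ U then g ⟨i, h⟩ else ω₀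

variable [Fintype Ω] [CommRing R]

/-- **the product expectation of the region `U`** (*"⟨·⟩ … defined by integrating over the fields in X only"*, p. 306, in the simplest
measure: finitely many field values per cube, counting measure): the sum of `h` over the configurations on `U` (base point elsewhere),
an `R`-linear functional on the observables. [cite: BalabanImbrieJaffe1988, p.306 (Sect. 5.13)] -/
def prodE (ω₀ : Ω) (U : Finset ι) : ((ι → Ω) → R) →ₗ[R] R where
  toFun h := ∑ g : U → Ω, h (extend ω₀ U g)
  map_add' h h' := by simp only [Pi.add_apply, sum_add_distrib]
  map_smul' c h := by simp only [Pi.smul_apply, smul_eq_mul, RingHom.id_apply, mul_sum]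

/-- unfolding `prodE`. [cite: BalabanImbrieJaffe1988, p.306 (Sect. 5.13)] -/
theorem prodE_apply (ω₀ : Ω) (U : Finset ι) (h : (ι → Ω) → R) : prodE ω₀ U h = ∑ g : U → Ω, h (extend ω₀ U g) := rfl

/-- **the product expectation factorizes over disjoint regions for localized factors** (the decoupled situation *"at s = 0"*).
[cite: BalabanImbrieJaffe1988, p.306 (Sect. 5.13)] -/
theorem prodE_union_mul (ω₀ : Ω) {U V : Finset ι} (hUV : Disjoint U V) {h h' : (ι → Ω) → R} (hh : DependsOn h U)
    (hh' : DependsOn h' V) : prodE ω₀ (U ∪ V) (h * h') = prodE ω₀ U h * prodE ω₀ V h' := by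
  simp only [prodE_apply, Pi.mul_apply]
  let e := Equiv.piFinsetUnion (fun _ : ι => Ω) hUV
  have hU : ∀ p : (U → Ω) × (V → Ω), ∀ i ∈ U, extend ω₀ (U ∪ V) (e p) i = extend ω₀ U p.1 i := by
    intro p i hi
    have hi' : i ∈ U ∪ V := mem_union_left V hi
    simp only [extend, dif_pos hi, dif_pos hi']
    exact Equiv.piFinsetUnion_left (fun _ : ι => Ω) hUV hi hi'
  have hV : ∀ p : (U → Ω) × (V → Ω), ∀ i ∈ V, extend ω₀ (U ∪ V) (e p) i = extend ω₀ V p.2 i := by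
    intro p i hi
    have hi' : i ∈ U ∪ V := mem_union_right U hi
    simp only [extend, dif_pos hi, dif_pos hi']
    exact Equiv.piFinsetUnion_right (fun _ : ι => Ω) hUV hi hi'
  calc ∑ g : ↥(U ∪ V) → Ω, h (extend ω₀ (U ∪ V) g) * h' (extend ω₀ (U ∪ V) g)
      = ∑ p : (U → Ω) × (V → Ω), h (extend ω₀ (U ∪ V) (e p)) * h' (extend ω₀ (U ∪ V) (e p)) :=
        (Fintype.sum_equiv e _ _ fun _ => rfl).symm
    _ = ∑ p : (U → Ω) × (V → Ω), h (extend ω₀ U p.1) * h' (extend ω₀ V p.2) :=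
        Fintype.sum_congr _ _ fun p => by rw [hh _ _ (hU p), hh' _ _ (hV p)]
    _ = (∑ g : U → Ω, h (extend ω₀ U g)) * ∑ g : V → Ω, h' (extend ω₀ V g) := by
        rw [Fintype.sum_prod_type, sum_mul_sum]

/-- factorization over a pairwise disjoint family of regions (blocks of a filling) for block-localized factors.
[cite: BalabanImbrieJaffe1988, p.306 (Sect. 5.13)] -/
theorem prodE_biUnion_prod (ω₀ : Ω) (π : Finset (Finset ι)) (hπ : (π : Set (Finset ι)).PairwiseDisjoint id)
    (F : Finset ι → (ι → Ω) → R) (hF : ∀ P ∈ π, DependsOn (F P) P) :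
    prodE ω₀ (π.biUnion id) (fun φ => ∏ P ∈ π, F P φ) = ∏ P ∈ π, prodE ω₀ P (F P) := by
  induction π using Finset.induction_on with
  | empty =>
    -- one configuration on the empty set of cubes
    rw [biUnion_empty, prod_empty, prodE_apply]
    simp only [prod_empty, sum_const, card_univ, Fintype.card_pi, Finset.prod_const, Finset.univ_eq_empty, card_empty,
      pow_zero, one_smul]
  | insert P π' hP ih =>
    have hπ' : (π' : Set (Finset ι)).PairwiseDisjoint id := hπ.subset (coe_subset.2 (subset_insert _ _))
    have hdisj : Disjoint P (π'.biUnion id) := by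
      rw [disjoint_biUnion_right]
      intro Q hQ
      exact hπ (mem_coe.2 (mem_insert_self P π')) (mem_coe.2 (mem_insert_of_mem hQ)) (fun h => hP (h ▸ hQ))
    rw [biUnion_insert, prod_insert hP, ← ih hπ' fun Q hQ => hF Q (mem_insert_of_mem hQ), id,
      ← prodE_union_mul ω₀ hdisj (hF P (mem_insert_self P π'))
        (DependsOn.prod π' F fun Q hQ => (hF Q (mem_insert_of_mem hQ)).mono (subset_biUnion_of_mem id hQ))]
    simp only [Pi.mul_def, prod_insert hP]

/-- for Mayer polymers inside the region, *"assigned to the region containing Y ∩ W"* is *"contained in"*. [cite: BalabanImbrieJaffe1988, p.304 (Sect. 5.13)] -/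
theorem filter_inter_subset_eq_restrictTo {S : Finset (Finset ι)} {W' P : Finset ι} (hS : ∀ Y ∈ S, Y ⊆ W') :
    S.filter (fun Y => Y ∩ W' ⊆ P) = restrictTo S P := by
  ext Y
  simp only [mem_filter, mem_restrictTo, and_congr_right_iff]
  intro hY
  rw [inter_eq_left.2 (hS Y hY)]

/-- the activity of an elementary region in the product model: the product expectation, over the configurations on `P`, of the
one-cube factors of `P` times the Mayer factors of the polymers `T`. [cite: BalabanImbrieJaffe1988, p.306 (Sect. 5.13)] -/
def eProd (ω₀ : Ω) (f : ι → (ι → Ω) → R) (b : Finset ι → (ι → Ω) → R) (P : Finset ι) (T : Finset (Finset ι)) : R :=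
  prodE ω₀ P fun φ => (∏ Y ∈ T, (b Y φ - 1)) * ∏ α ∈ P, f α φ

/-- **the factorization hypothesis `hfac` of `hdec_of_factorizes` HOLDS in the product model**: with the product expectation `prodE`,
one-cube factors `f α` (localized in `{α}`: the cut-offs and observables of single cubes) and Boltzmann factors `b Y` localized in `Y`,
the expectation `⟨G_{W'} Π_{Y∈S}(b_Y − 1)⟩` is the product over the elementary regions of `S` of their activities `eProd` — via the
regrouping `prod_regroup` (*"no overlap of factors between different □_i's"*) and `prodE_biUnion_prod`. [cite: BalabanImbrieJaffe1988, p.306 (Sect. 5.13)] -/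
theorem zS_prodE_eq_prod_regions (ω₀ : Ω) (f : ι → (ι → Ω) → R) (hf : ∀ α, DependsOn (f α) {α}) (b : Finset ι → (ι → Ω) → R)
    (hb : ∀ Y, DependsOn (b Y) Y) (Ys : Finset (Finset ι)) (hYs : ∀ Y ∈ Ys, Y.Nonempty) (W' : Finset ι) :
    ∀ S ⊆ polysIn Ys W',
      zS (fun U => prodE ω₀ U) (fun U φ => ∏ α ∈ U, f α φ) b W' S = ∏ P ∈ regions S W', eProd ω₀ f b P (restrictTo S P) := by
  intro S hS
  have hSW : ∀ Y ∈ S, Y ⊆ W' := fun Y hY => (mem_polysIn.1 (hS hY)).2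
  have hne : ∀ Y ∈ S, (Y ∩ W').Nonempty := fun Y hY => by
    rw [inter_eq_left.2 (hSW Y hY)]
    exact hYs Y (mem_polysIn.1 (hS hY)).1
  -- the integrand regrouped over the elementary regions, pointwise in the configuration
  have hint : ((fun U φ => ∏ α ∈ U, f α φ) W' * mayer b S) =
      fun φ => ∏ P ∈ regions S W', ((∏ Y ∈ restrictTo S P, (b Y φ - 1)) * ∏ α ∈ P, f α φ) := by
    funext φ
    simp only [Pi.mul_apply, mayer]
    rw [mul_comm, prod_regroup (J := S) Subset.rfl hne (fun Y => b Y φ - 1) (fun α => f α φ)]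
    exact prod_congr rfl fun P _ => by rw [filter_inter_subset_eq_restrictTo hSW]
  rw [zS, hint]
  have key := prodE_biUnion_prod ω₀ (regions S W') (isSetPartition_regions S W').pairwiseDisjoint
    (fun P φ => (∏ Y ∈ restrictTo S P, (b Y φ - 1)) * ∏ α ∈ P, f α φ) fun P _ =>
      (DependsOn.prod _ _ fun Y hY => ((hb Y).sub_one).mono (mem_restrictTo.1 hY).2).mul
        (DependsOn.prod _ _ fun α hα => (hf α).mono (singleton_subset_iff.2 hα))
  rw [(isSetPartition_regions S W').biUnion_id] at key
  exact key

/-- **(5.14.1)'s resummation in the product model, hypothesis-free**: `z_F(W') = Σ_{{X_α} filling W'} Π_α g₂(X_α)` with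
`g₂(X) = Σ_{T ⊆ 𝒫(X), X a single T-region} eProd X T` — `BIJ88Resummation5141.zF_eq_sum_fillings` with its decoupling hypothesis
DISCHARGED (`zS_prodE_eq_prod_regions` + `hdec_of_factorizes`); only the nonemptiness of the Mayer polymers remains.
[cite: BalabanImbrieJaffe1988, (5.14.1) p.308] -/
theorem zF_prodE_eq_sum_fillings (ω₀ : Ω) (f : ι → (ι → Ω) → R) (hf : ∀ α, DependsOn (f α) {α}) (b : Finset ι → (ι → Ω) → R)
    (hb : ∀ Y, DependsOn (b Y) Y) (Ys : Finset (Finset ι)) (hYs : ∀ Y ∈ Ys, Y.Nonempty) (W' : Finset ι) :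
    zF (fun U => prodE ω₀ U) (fun U φ => ∏ α ∈ U, f α φ) Ys b W' =
      ∑ κ ∈ setPartitions W', ∏ X ∈ κ, g2 Ys (gOne (eProd ω₀ f b)) X :=
  zF_eq_sum_fillings_of_factorizes _ _ Ys b (eProd ω₀ f b) W' hYs (zS_prodE_eq_prod_regions ω₀ f hf b hb Ys hYs W')

end ProductModel

end Literature.MathematicalPhysics.QuantumFieldTheory.BalabanImbrieJaffe1984to88.BIJ88ElementaryRegions304
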